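import Mathlib
import Summits.NavierStokesRegularity.NavierStokesRegularity.Theses.LevelSetModeration
import Summits.NavierStokesRegularity.NavierStokesRegularity.Theorems.LevelSetModerationLevelSetEnergyInequalitySlices
import Summits.NavierStokesRegularity.NavierStokesRegularity.Theorems.TypeICertificateLadderRungReynoldsOneTaoCover
import Literature.Analysis.FluidPDE.NormalisedPressureDischarge

/-!
# Route LevelSetModeration — `LevelSetEnergyInequality` (item stmt-NavierStokesRegularity-18151)

**Vasseur's level-set energy inequality, globalised for the speed** (Vasseur 2007, Lemma 11 and
(12)): for a classical solution `(u, p)` of the unforced Navier–Stokes system on `ℝ³ × [0, T)` which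
is Leray–Hopf from its rapidly decaying datum, and a level `c > 0` above the initial speed maximum,
for every `t < T`

  `∫ (|u(t)| - c)₊² + 2ν ∫₀ᵗ∫ 1_{|u|>c} |∇|u||² ≤ -2 ∫₀ᵗ∫ (1 - c/|u|)₊ u·∇p̃[u]`,

with `p̃[u]` Tao's normalised (Riesz-transform) pressure.

## Proof

The deep input is Tao 2013 (Cor. 11.1 + Thm. 5.4), in the tree as
`RungReynoldsOne.stub_taoCover`: on the closed slab `[0, t]` the solution carries a pressure `q`
with `u, ∂ₜu, q ∈ L^∞_t H^k_x` for all `k` (so `u` is bounded and every pairing below is a genuine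
`L¹` integral on `ℝ³`, no cut-offs). With the weight `k₀(u) = (|u|-c)₊/max(|u|,c) = (1-c/|u|)₊`:
* at each time, `∫ k₀⟪∂ₜu, u⟫ = ν∫ k₀⟪Δu, u⟫ - ∫ k₀⟪∇q, u⟫` (`slice_identity`: the transport term
  is `½∫ u·∇(|u|-c)₊² = 0`), and `∫ k₀⟪Δu, u⟫ ≤ -∫ 1_{|u|>c} Σᵢ⟪u,∂ᵢu⟫²/|u|²` (`viscous_slice`,
  whole-space integration by parts with a regularised truncation), the right side dominating the
  printed dissipation `∫ 1_{|u|>c} ‖D|u|‖²` (`lintegral_levelSet_fderiv_norm_le`);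
* in time, `∫(|u(t)|-c)₊² - ∫(|u(0)|-c)₊² = 2∫₀ᵗ∫ k₀⟪∂ₜu, u⟫` (`truncSq_balance`) with
  `∫(|u(0)|-c)₊² = 0`;
* `∇q = ∇p̃[u]` for a.e. time by Tao's pressure normalisation (Lemma 4.1 (i),
  `tao_pressure_normalisation_holds`), which turns `∫ k₀⟪∇q, u⟫` into the printed pressure work
  (`integral_weight_pressure_eq`).

## References
* A. F. Vasseur, *A new proof of partial regularity of solutions to Navier–Stokes equations*,
  NoDEA 14 (2007), Lemma 11, (12). [Vasseur2007]
* T. Tao, *Localisation and compactness properties of the Navier–Stokes global regularity problem*,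
  Anal. PDE 6 (2013), Lemma 4.1 (i), Thm. 5.4, Cor. 11.1. [Tao2011]
* J. C. Robinson, J. L. Rodrigo, W. Sadowski, *The Three-Dimensional Navier–Stokes Equations*,
  CUP 2016, Thm. 6.8, Thm. 8.17. [RobinsonRodrigoSadowski2016]
-/

noncomputable section

-- single-conjunct summit: `Summit.<Summit>.<Problem>` repeats the name by the D-0017 layout
set_option linter.dupNamespace false

namespace Summit.NavierStokesRegularity.NavierStokesRegularity.Theorems

open Real Set Filter Topology MeasureTheory InnerProductSpace Function
open scoped RealInnerProductSpace ENNReal NNReal Laplacian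
open Literature.Analysis.FluidPDE
open Summit.NavierStokesRegularity.NavierStokesRegularity.Theorems.LevelSetEnergyInequality

/-- **The level-set energy inequality on a Tao-class slab.** For a classical solution `(u, q)` of
the unforced Navier–Stokes system on the closed slab `[0, t] × ℝ³`, `t > 0`, with `u`, `∂ₜu` and
`q` having the relevant `L²` Sobolev norms bounded on `[0, t]`, `u` bounded, and a level `c > 0`
with `|u(0)| ≤ c`: `∫(|u(t)|-c)₊² + 2ν·(level-set dissipation on (0,t)) ≤ -2∫₀ᵗ∫ k₀(u)⟪∇q, u⟫`
(Vasseur 2007, Lemma 11, assembled from `truncSq_balance`, `slice_identity`, `viscous_slice`,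
`lintegral_levelSet_fderiv_norm_le`). -/
theorem levelSetEnergyInequality_slab {ν t c B : ℝ} (hν : 0 < ν) (ht : 0 < t) (hc : 0 < c)
    {u : ℝ → EuclideanSpace ℝ (Fin 3) → EuclideanSpace ℝ (Fin 3)}
    {q : ℝ → EuclideanSpace ℝ (Fin 3) → ℝ}
    (hcl : IsClassicalNSSolutionOn (Icc 0 t) ν 0 u q) (hB : ∀ τ ∈ Icc 0 t, ∀ x, ‖u τ x‖ ≤ B)
    {C₀ C₁ C₂ Ct Cq : ℝ≥0} (hC₀ : ∀ τ ∈ Icc 0 t, ∫⁻ x, ‖u τ x‖ₑ ^ 2 ≤ C₀)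
    (hC₁ : ∀ τ ∈ Icc 0 t, ∫⁻ x, ‖iteratedFDeriv ℝ 1 (u τ) x‖ₑ ^ 2 ≤ C₁)
    (hC₂ : ∀ τ ∈ Icc 0 t, ∫⁻ x, ‖iteratedFDeriv ℝ 2 (u τ) x‖ₑ ^ 2 ≤ C₂)
    (hCt : ∀ τ ∈ Icc 0 t, ∫⁻ x, ‖timeDerivWithin (Icc 0 t) u τ x‖ₑ ^ 2 ≤ Ct)
    (hCq : ∀ τ ∈ Icc 0 t, ∫⁻ x, ‖iteratedFDeriv ℝ 1 (q τ) x‖ₑ ^ 2 ≤ Cq)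
    (hc0 : ∀ x, ‖u 0 x‖ ≤ c) :
    (∫ x, (max (‖u t x‖ - c) 0) ^ 2) + 2 * ν * (∫⁻ τ in Ioo 0 t, ∫⁻ x, Set.indicator
        {x | c < ‖u τ x‖} (fun x => ENNReal.ofReal (‖fderiv ℝ (fun y => ‖u τ y‖) x‖ ^ 2)) x).toReal
      ≤ -(2 * ∫ τ in Ioo 0 t, ∫ x, max (‖u τ x‖ - c) 0 / max ‖u τ x‖ c *
          ⟪gradient (q τ) x, u τ x⟫) := by
  set e := EuclideanSpace.basisFun (Fin 3) ℝ with he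
  have hU : UniqueDiffOn ℝ (Icc 0 t) := uniqueDiffOn_Icc ht
  -- slice regularity and `L²` finiteness
  have hu2 : ∀ τ ∈ Icc 0 t, ContDiff ℝ 2 (u τ) := fun τ hτ =>
    (hcl.contDiff_velocity hτ).of_le (by norm_cast)
  have hq1 : ∀ τ ∈ Icc 0 t, ContDiff ℝ 1 (q τ) := fun τ hτ =>
    (hcl.contDiff_pressure hτ).of_le (by norm_cast)
  have f0 : ∀ τ ∈ Icc 0 t, ∫⁻ x, ‖u τ x‖ₑ ^ 2 < ⊤ := fun τ hτ => (hC₀ τ hτ).trans_lt ENNReal.coe_lt_top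
  have f1 : ∀ τ ∈ Icc 0 t, ∫⁻ x, ‖iteratedFDeriv ℝ 1 (u τ) x‖ₑ ^ 2 < ⊤ := fun τ hτ =>
    (hC₁ τ hτ).trans_lt ENNReal.coe_lt_top
  have f2 : ∀ τ ∈ Icc 0 t, ∫⁻ x, ‖iteratedFDeriv ℝ 2 (u τ) x‖ₑ ^ 2 < ⊤ := fun τ hτ =>
    (hC₂ τ hτ).trans_lt ENNReal.coe_lt_top
  have fq : ∀ τ ∈ Icc 0 t, ∫⁻ x, ‖iteratedFDeriv ℝ 1 (q τ) x‖ₑ ^ 2 < ⊤ := fun τ hτ =>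
    (hCq τ hτ).trans_lt ENNReal.coe_lt_top
  -- the slice identity `∫ k₀⟪W, u⟫ = ν ∫ k₀⟪Δu, u⟫ - ∫ k₀⟪∇q, u⟫`
  have hslice : ∀ τ ∈ Icc 0 t,
      ∫ x, max (‖u τ x‖ - c) 0 / max ‖u τ x‖ c * ⟪timeDerivWithin (Icc 0 t) u τ x, u τ x⟫ =
        ν * (∫ x, max (‖u τ x‖ - c) 0 / max ‖u τ x‖ c * ⟪(Δ (u τ)) x, u τ x⟫) -
          ∫ x, max (‖u τ x‖ - c) 0 / max ‖u τ x‖ c * ⟪gradient (q τ) x, u τ x⟫ := by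
    intro τ hτ
    have hmom : ∀ x, timeDerivWithin (Icc 0 t) u τ x + fderiv ℝ (u τ) x (u τ x) =
        ν • (Δ (u τ)) x - gradient (q τ) x := by
      intro x
      have := hcl.momentum τ hτ x
      simp only [convect_apply, Pi.zero_apply, add_zero] at this
      exact this
    exact slice_identity hc (hu2 τ hτ) (hq1 τ hτ) hmom (hcl.divFree τ hτ) (hB τ hτ) (f0 τ hτ)
      (f1 τ hτ) (f2 τ hτ) (fq τ hτ)
  -- the viscous inequality and the dissipation, slice by slice
  have hvisc : ∀ τ ∈ Icc 0 t,
      ∫ x, max (‖u τ x‖ - c) 0 / max ‖u τ x‖ c * ⟪(Δ (u τ)) x, u τ x⟫ ≤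
        -∫ x, Set.indicator {x | c < ‖u τ x‖}
          (fun x => (∑ i, ⟪u τ x, fderiv ℝ (u τ) x (e i)⟫ ^ 2) / max ‖u τ x‖ c ^ 2) x :=
    fun τ hτ => viscous_slice hc (hu2 τ hτ) (f0 τ hτ) (f1 τ hτ) (f2 τ hτ)
  have hdiss : ∀ τ ∈ Icc 0 t,
      ∫⁻ x, Set.indicator {x | c < ‖u τ x‖}
          (fun x => ENNReal.ofReal (‖fderiv ℝ (fun y => ‖u τ y‖) x‖ ^ 2)) x ≤
        ENNReal.ofReal (-∫ x, max (‖u τ x‖ - c) 0 / max ‖u τ x‖ c * ⟪(Δ (u τ)) x, u τ x⟫) :=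
    fun τ hτ => (lintegral_levelSet_fderiv_norm_le hc ((hu2 τ hτ).of_le one_le_two) (f1 τ hτ)).trans
      (ENNReal.ofReal_le_ofReal (by linarith [hvisc τ hτ]))
  -- time integrability of the viscous and pressure pairings (slab bounds)
  have cu : ContinuousOn (uncurry u) (Icc 0 t ×ˢ univ) := hcl.smooth_velocity.continuousOn
  have cΔ : ContinuousOn (uncurry fun τ x => (Δ (u τ)) x) (Icc 0 t ×ˢ univ) :=
    (hcl.smooth_velocity.laplacian hU).continuousOn
  have cgq : ContinuousOn (uncurry fun τ x => gradient (q τ) x) (Icc 0 t ×ˢ univ) :=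
    (hcl.smooth_pressure.gradient hU).continuousOn
  have ck : Continuous fun v : EuclideanSpace ℝ (Fin 3) => max (‖v‖ - c) 0 / max ‖v‖ c :=
    continuous_weight hc
  have hkabs : ∀ v : EuclideanSpace ℝ (Fin 3), |max (‖v‖ - c) 0 / max ‖v‖ c| ≤ 1 := fun v => by
    rw [abs_of_nonneg (weight_nonneg hc v)]; exact weight_le_one hc v
  have hCΔ : ∀ τ ∈ Icc 0 t, ∫⁻ x, ‖(Δ (u τ)) x‖ₑ ^ 2 ≤ ((3 : ℝ≥0) ^ 2 * C₂ : ℝ≥0) := fun τ hτ => by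
    have h := lintegral_enorm_sq_le_of_norm_le_mul (μ := volume) (3 : ℝ≥0)
      (fun x => norm_laplacian_le_three_mul_norm_iteratedFDeriv_two (hu2 τ hτ) x)
    refine h.trans ?_
    push_cast
    gcongr
    exact hC₂ τ hτ
  have hCgq : ∀ τ ∈ Icc 0 t, ∫⁻ x, ‖gradient (q τ) x‖ₑ ^ 2 ≤ Cq := fun τ hτ =>
    le_of_eq_of_le (lintegral_congr fun x => by
      rw [← ofReal_norm, norm_gradient_eq_norm_iteratedFDeriv_one, ofReal_norm]) (hCq τ hτ)
  have iA : IntegrableOn (fun τ => ∫ x, max (‖u τ x‖ - c) 0 / max ‖u τ x‖ c *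
      ⟪(Δ (u τ)) x, u τ x⟫) (Ioo 0 t) volume := by
    have h := integrable_slab_of_pairing_bound (T := t)
      (g := fun z => max (‖u z.1 z.2‖ - c) 0 / max ‖u z.1 z.2‖ c * ⟪(Δ (u z.1)) z.2, u z.1 z.2⟫)
      (a := fun τ x => (Δ (u τ)) x) (b := u) ((ck.comp_continuousOn cu).mul (cΔ.inner cu))
      (fun τ _ x => by
        rw [abs_mul]
        exact (mul_le_of_le_one_left (abs_nonneg _) (hkabs _)).trans (abs_real_inner_le_norm _ _))
      (fun τ hτ => continuous_laplacian (hu2 τ hτ)) hCΔ hC₀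
    exact h.integral_prod_left
  have iP : IntegrableOn (fun τ => ∫ x, max (‖u τ x‖ - c) 0 / max ‖u τ x‖ c *
      ⟪gradient (q τ) x, u τ x⟫) (Ioo 0 t) volume := by
    have h := integrable_slab_of_pairing_bound (T := t)
      (g := fun z => max (‖u z.1 z.2‖ - c) 0 / max ‖u z.1 z.2‖ c * ⟪gradient (q z.1) z.2, u z.1 z.2⟫)
      (a := fun τ x => gradient (q τ) x) (b := u) ((ck.comp_continuousOn cu).mul (cgq.inner cu))
      (fun τ _ x => by
        rw [abs_mul]
        exact (mul_le_of_le_one_left (abs_nonneg _) (hkabs _)).trans (abs_real_inner_le_norm _ _))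
      (fun τ hτ => continuous_gradient_of_contDiff (hq1 τ hτ)) hCgq hC₀
    exact h.integral_prod_left
  -- the time balance
  obtain ⟨-, hbal⟩ := truncSq_balance hc ht hcl.smooth_velocity hC₀ hCt
  have hinit : ∫ x, (max (‖u 0 x‖ - c) 0) ^ 2 = 0 :=
    integral_eq_zero_of_ae (Eventually.of_forall fun x => truncSq_eq_zero_of_norm_le _ (hc0 x))
  have hPt : ∫ τ in Ioo 0 t, ∫ x, max (‖u τ x‖ - c) 0 / max ‖u τ x‖ c *
      ⟪timeDerivWithin (Icc 0 t) u τ x, u τ x⟫ =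
      ν * (∫ τ in Ioo 0 t, ∫ x, max (‖u τ x‖ - c) 0 / max ‖u τ x‖ c * ⟪(Δ (u τ)) x, u τ x⟫) -
        ∫ τ in Ioo 0 t, ∫ x, max (‖u τ x‖ - c) 0 / max ‖u τ x‖ c * ⟪gradient (q τ) x, u τ x⟫ := by
    rw [setIntegral_congr_fun measurableSet_Ioo fun τ hτ => hslice τ (Ioo_subset_Icc_self hτ),
      integral_sub (iA.const_mul ν) iP, integral_const_mul]
  -- the dissipation integral is dominated by `-∫ Av`
  have hnn : 0 ≤ᵐ[volume.restrict (Ioo 0 t)] fun τ =>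
      -∫ x, max (‖u τ x‖ - c) 0 / max ‖u τ x‖ c * ⟪(Δ (u τ)) x, u τ x⟫ := by
    refine (ae_restrict_iff' measurableSet_Ioo).2 (Eventually.of_forall fun τ hτ => ?_)
    show (0 : ℝ) ≤ -∫ x, max (‖u τ x‖ - c) 0 / max ‖u τ x‖ c * ⟪(Δ (u τ)) x, u τ x⟫
    have h := hvisc τ (Ioo_subset_Icc_self hτ)
    have h0 : 0 ≤ ∫ x, Set.indicator {x | c < ‖u τ x‖}
        (fun x => (∑ i, ⟪u τ x, fderiv ℝ (u τ) x (e i)⟫ ^ 2) / max ‖u τ x‖ c ^ 2) x :=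
      integral_nonneg fun x => Set.indicator_nonneg (fun y _ =>
        div_nonneg (Finset.sum_nonneg fun i _ => sq_nonneg _) (sq_nonneg _)) x
    linarith
  have hD : (∫⁻ τ in Ioo 0 t, ∫⁻ x, Set.indicator {x | c < ‖u τ x‖}
      (fun x => ENNReal.ofReal (‖fderiv ℝ (fun y => ‖u τ y‖) x‖ ^ 2)) x) ≤
      ENNReal.ofReal (∫ τ in Ioo 0 t,
        -∫ x, max (‖u τ x‖ - c) 0 / max ‖u τ x‖ c * ⟪(Δ (u τ)) x, u τ x⟫) := by
    have iAn : Integrable (fun τ => -∫ x, max (‖u τ x‖ - c) 0 / max ‖u τ x‖ c *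
        ⟪(Δ (u τ)) x, u τ x⟫) (volume.restrict (Ioo 0 t)) := iA.neg
    rw [ofReal_integral_eq_lintegral_ofReal iAn hnn]
    exact setLIntegral_mono' measurableSet_Ioo fun τ hτ => hdiss τ (Ioo_subset_Icc_self hτ)
  have hDreal : (∫⁻ τ in Ioo 0 t, ∫⁻ x, Set.indicator {x | c < ‖u τ x‖}
      (fun x => ENNReal.ofReal (‖fderiv ℝ (fun y => ‖u τ y‖) x‖ ^ 2)) x).toReal ≤
      -∫ τ in Ioo 0 t, ∫ x, max (‖u τ x‖ - c) 0 / max ‖u τ x‖ c * ⟪(Δ (u τ)) x, u τ x⟫ := by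
    have h := ENNReal.toReal_le_of_le_ofReal (integral_nonneg_of_ae hnn) hD
    rwa [integral_neg] at h
  -- assemble
  rw [hinit, zero_add, hPt] at hbal
  linarith [hbal, mul_le_mul_of_nonneg_left hDreal (by positivity : (0 : ℝ) ≤ 2 * ν)]

/-- **`LevelSetEnergyInequality`** (item stmt-NavierStokesRegularity-18151 of route
LevelSetModeration): Vasseur's level-set energy inequality for the speed of a classical Leray–Hopf
solution from a rapidly decaying datum, with Tao's normalised pressure (Vasseur 2007, Lemma 11
globalised; Tao 2013, Lemma 4.1 (i), Thm. 5.4, Cor. 11.1). -/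
theorem levelSetModeration_levelSetEnergyInequality_proof :
    Summit.NavierStokesRegularity.NavierStokesRegularity.Theses.LevelSetModeration.LevelSetEnergyInequality := by
  intro ν T hν hT u p hcl hLH hdec c hc hc0 t ht
  rcases ht.1.eq_or_lt with h0t | htpos
  · -- `t = 0`: every term vanishes
    rw [← h0t]
    have hinit : ∫ x, (max (‖u 0 x‖ - c) 0) ^ 2 = 0 :=
      integral_eq_zero_of_ae (Eventually.of_forall fun x => truncSq_eq_zero_of_norm_le _ (hc0 x))
    simp only [Set.Ioo_self, Measure.restrict_empty, lintegral_zero_measure, integral_zero_measure,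
      ENNReal.toReal_zero, mul_zero, add_zero, neg_zero, hinit, le_refl]
  · -- `0 < t`: Tao-class cover of the closed slab `[0, t]`
    obtain ⟨q, hclq, hBu, hBut, hBq⟩ :=
      RungReynoldsOne.stub_taoCover hν hT hcl hLH hdec ⟨htpos, ht.2⟩
    obtain ⟨B, -, hB⟩ := exists_forall_norm_le_of_hasBoundedSobolevNormsOn hclq hBu
    obtain ⟨C₀', hC₀'⟩ := hBu 0
    obtain ⟨C₁, hC₁⟩ := hBu 1
    obtain ⟨C₂, hC₂⟩ := hBu 2
    obtain ⟨Ct', hCt'⟩ := hBut 0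
    obtain ⟨Cq, hCq⟩ := hBq 1
    have hC₀ : ∀ τ ∈ Icc 0 t, ∫⁻ x, ‖u τ x‖ₑ ^ 2 ≤ C₀' := fun τ hτ =>
      le_of_eq_of_le (lintegral_congr fun x => by
        rw [← ofReal_norm, ← ofReal_norm (iteratedFDeriv ℝ 0 (u τ) x), norm_iteratedFDeriv_zero])
        (hC₀' τ hτ)
    have hCt : ∀ τ ∈ Icc 0 t, ∫⁻ x, ‖timeDerivWithin (Icc 0 t) u τ x‖ₑ ^ 2 ≤ Ct' := fun τ hτ =>
      le_of_eq_of_le (lintegral_congr fun x => by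
        rw [← ofReal_norm, ← ofReal_norm (iteratedFDeriv ℝ 0 (timeDerivWithin (Icc 0 t) u τ) x),
          norm_iteratedFDeriv_zero]) (hCt' τ hτ)
    have hslab := levelSetEnergyInequality_slab hν htpos hc hclq hB hC₀ hC₁ hC₂ hCt hCq hc0
    -- the pressure work in printed form: `∇q = ∇p̃[u]` for a.e. `τ` (Tao, Lemma 4.1 (i))
    have hE : ∃ C : ℝ≥0∞, C < ⊤ ∧ ∀ τ ∈ Icc 0 t, ∫⁻ x, ‖u τ x‖ₑ ^ 2 ≤ C :=
      ⟨C₀', ENNReal.coe_lt_top, hC₀⟩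
    obtain ⟨Cf, -, -, hae⟩ := tao_pressure_normalisation_holds ν t hν htpos u q hclq hE
    have hae' : ∀ᵐ τ ∂(volume.restrict (Ioo 0 t)),
        ∫ x, max (‖u τ x‖ - c) 0 / max ‖u τ x‖ c * ⟪gradient (q τ) x, u τ x⟫ =
          ∫ x, max (1 - c / ‖u τ x‖) 0 * (fderiv ℝ (normalisedPressure (u τ)) x (u τ x)) := by
      filter_upwards [ae_restrict_of_ae_restrict_of_subset Ioo_subset_Icc_self hae] with τ hτ
      exact integral_weight_pressure_eq hc hτ
    rw [← integral_congr_ae hae']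
    exact hslab

end Summit.NavierStokesRegularity.NavierStokesRegularity.Theorems

end
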